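import Mathlib
import Literature.Computability.Complexity.ExtMonotoneGRankSupport

/-!
# Route ConvexRankGates — crux `LinAlgGateBlind` (stmt-PneNP-10681), support:
# parallel argument positions of PERM / GRANK gates act as an OR (`Lin ∘ OR ⊆ Lin`, same size)

The gate classes of the crux `Summit.PneNP.PneNP.Theses.ConvexRankGates.LinAlgGateBlind`
(`IsPermGate`, `IsGRankGate` of `Literature/Computability/Complexity/ExtMonotoneGates.lean`) are
closed under feeding an argument position with an OR of inputs, WITHOUT changing the size
parameter `s` (number of points / dimension) or, for GRANK, the field: duplicate the position once
per disjunct ("parallel positions") and let each copy read one disjunct.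

* `isPermGate_parallel` — PERM: copies `j` of position `π j` carry the same permutation `σ_{π j}`;
  the selected generator SETS coincide, `{σ'_j : z_j = 1} = {σ_a : ∃ j, π j = a ∧ z_j = 1}`.
* `le_rank_symbolicMatrix_parallel_iff` / `isGRankGate_parallel` — GRANK: copies carry the same
  matrix `K_{π j}`; the killed symbolic matrix of the parallel gate at `z` is the image of the killed
  symbolic matrix of the original gate at `y_a = ⋁_{π j = a} z_j` under the `F`-algebra map
  `φ_z : Y_a ↦ ∑_{π j = a, z_j = 1} X_j` (`aeval_parallel_symbolicPolyMatrix`), and `φ_z` is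
  injective on polynomials in the live variables — it has the left inverse "keep the LEAST live
  copy of each position" (`leftInv_comp_parallel`) — so a minor is non-zero iff its image is:
  equal generic rank thresholds, SAME dimension, same field.
* `isPermGate_substOr`, `isGRankGate_substOr` — the OR-substitution form used by approximation-
  method lines (a wide gate fed by DNFs is ONE wide gate over the DNFs' terms): for
  `S : Fin k → Finset (Fin N)`, the function `x ↦ g (fun a => ⋁_{i ∈ S a} x_i)` is again a PERM
  (with a wiring of positions to inputs) resp. GRANK gate of the same size parameter.

All statements are def-free. References: J. Edmonds, *Systems of distinct representatives and
linear algebra*, J. Res. NBS 71B (1967) §5–7 (generic rank = largest non-vanishing minor)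
[Edmonds1967]; the OR-closure itself is folklore (cf. Oliveira–Pudlák 2019, §4, for LP gates).
-/

namespace Summit.PneNP.PneNP.Theorems

open Literature.Computability.Complexity MvPolynomial Matrix

/-! ### PERM: parallel positions -/

/-- **Parallel positions of a PERM gate act as an OR.** If `g` is a PERM gate on `≤ s` points with
`k` positions and `π : Fin M → Fin k` assigns to each of `M` new positions an old one, then
`z ↦ g (fun a => ⋁_{π j = a} z_j)` is a PERM gate on the same points (copy `j` carries `σ_{π j}`).
[folklore] -/
theorem isPermGate_parallel {s : ℕ} {g : GateFn} (hg : IsPermGate s g) {M : ℕ}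
    (π : Fin M → Fin g.1) :
    IsPermGate s ⟨M, fun z => g.2 fun a => decide (∃ j, π j = a ∧ z j = true)⟩ := by
  obtain ⟨d, hd, σ, τ, hg⟩ := hg
  refine ⟨d, hd, fun j => σ (π j), τ, fun z => ?_⟩
  show g.2 (fun a => decide (∃ j, π j = a ∧ z j = true)) = true ↔ _
  rw [hg]
  have hset : σ '' {a | decide (∃ j, π j = a ∧ z j = true) = true} =
      (fun j => σ (π j)) '' {j | z j = true} := by
    ext p
    simp only [Set.mem_image, Set.mem_setOf_eq, decide_eq_true_eq]
    constructor
    · rintro ⟨a, ⟨j, rfl, hj⟩, rfl⟩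
      exact ⟨j, hj, rfl⟩
    · rintro ⟨j, hj, rfl⟩
      exact ⟨π j, ⟨j, rfl, hj⟩, rfl⟩
  rw [hset]

/-! ### GRANK: parallel positions -/

section Parallel

variable {F : Type*} [Field F] {k M d : ℕ}

/-- The parallel-position substitution `Y_a ↦ ∑_{π j = a, z_j = 1} X_j` already kills the positions
`a` with no live copy: pre-composing with `killVars y`, `y_a = ⋁_{π j = a} z_j`, changes nothing.
[folklore] -/
theorem parallelSubst_comp_killVars (π : Fin M → Fin k) (z : Fin M → Bool) :
    (MvPolynomial.aeval (R := F) fun a : Fin k =>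
        ∑ j : Fin M, if π j = a ∧ z j = true then (X j : MvPolynomial (Fin M) F) else 0).comp
      (killVars fun a => decide (∃ j, π j = a ∧ z j = true)) =
    MvPolynomial.aeval (R := F) fun a : Fin k =>
        ∑ j : Fin M, if π j = a ∧ z j = true then (X j : MvPolynomial (Fin M) F) else 0 := by
  refine MvPolynomial.algHom_ext fun a => ?_
  simp only [AlgHom.comp_apply, killVars_X]
  by_cases ha : ∃ j, π j = a ∧ z j = true
  · rw [if_pos (decide_eq_true ha)]
  · rw [if_neg (by simpa using ha), map_zero, aeval_X]
    symm
    refine Finset.sum_eq_zero fun j _ => ?_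
    rw [if_neg]
    exact fun hj => ha ⟨j, hj⟩

/-- The parallel-position substitution followed by killing is killing followed by… nothing more:
`φ_z` lands in polynomials all of whose variables are live, so `killVars z ∘ φ_z = φ_z`. [folklore] -/
theorem killVars_comp_parallelSubst (π : Fin M → Fin k) (z : Fin M → Bool) :
    (killVars (F := F) z).comp (MvPolynomial.aeval (R := F) fun a : Fin k =>
        ∑ j : Fin M, if π j = a ∧ z j = true then (X j : MvPolynomial (Fin M) F) else 0) =
    MvPolynomial.aeval (R := F) fun a : Fin k =>
        ∑ j : Fin M, if π j = a ∧ z j = true then (X j : MvPolynomial (Fin M) F) else 0 := by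
  refine MvPolynomial.algHom_ext fun a => ?_
  simp only [AlgHom.comp_apply, aeval_X, map_sum]
  refine Finset.sum_congr rfl fun j _ => ?_
  by_cases hj : π j = a ∧ z j = true
  · rw [if_pos hj, killVars_X, if_pos hj.2]
  · rw [if_neg hj, map_zero]

/-- **The parallel gate's symbolic matrix is the image of the original one.** With copies `j`
carrying `K_{π j}`: killing the dead copies in `K₀ + ∑ⱼ Xⱼ K_{π j}` gives the image under
`φ_z : Y_a ↦ ∑_{π j = a, z_j = 1} X_j` of `K₀ + ∑ₐ Y_a K_a`. [folklore] -/
theorem aeval_parallel_symbolicPolyMatrix (π : Fin M → Fin k) (z : Fin M → Bool)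
    (K₀ : Matrix (Fin d) (Fin d) F) (K : Fin k → Matrix (Fin d) (Fin d) F) :
    (symbolicPolyMatrix K₀ K).map (MvPolynomial.aeval (R := F) fun a : Fin k =>
        ∑ j : Fin M, if π j = a ∧ z j = true then (X j : MvPolynomial (Fin M) F) else 0) =
      (symbolicPolyMatrix K₀ fun j => K (π j)).map (killVars z) := by
  refine Matrix.ext fun p q => ?_
  simp only [symbolicPolyMatrix, Matrix.map_apply, Matrix.add_apply, Matrix.sum_apply,
    Matrix.smul_apply, smul_eq_mul, map_add, map_sum, map_mul, MvPolynomial.algHom_C,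
    MvPolynomial.aeval_X, killVars_X, Finset.sum_mul]
  congr 1
  rw [Finset.sum_comm]
  refine Finset.sum_congr rfl fun j _ => ?_
  rw [Finset.sum_eq_single (π j)]
  · by_cases hz : z j = true
    · rw [if_pos ⟨rfl, hz⟩, if_pos hz]
    · rw [if_neg (fun h => hz h.2), if_neg hz]
  · intro a _ hne
    rw [if_neg (fun h => hne h.1.symm), zero_mul]
  · intro h
    exact absurd (Finset.mem_univ _) h

/-- **A left inverse of the parallel substitution on live polynomials.** Send the LEAST live copy
of each position back to the position's variable and every other copy to `0`; after `φ_z` this is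
exactly `killVars y`, `y_a = ⋁_{π j = a} z_j`. [folklore] -/
theorem leftInv_comp_parallel (π : Fin M → Fin k) (z : Fin M → Bool) :
    (MvPolynomial.aeval (R := F) fun j : Fin M =>
        if z j = true ∧ ∀ j' < j, ¬ (π j' = π j ∧ z j' = true)
        then (X (π j) : MvPolynomial (Fin k) F) else 0).comp
      (MvPolynomial.aeval (R := F) fun a : Fin k =>
        ∑ j : Fin M, if π j = a ∧ z j = true then (X j : MvPolynomial (Fin M) F) else 0) =
    killVars fun a => decide (∃ j, π j = a ∧ z j = true) := by
  classical
  refine MvPolynomial.algHom_ext fun a => ?_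
  simp only [AlgHom.comp_apply, aeval_X, map_sum, killVars_X]
  by_cases ha : ∃ j, π j = a ∧ z j = true
  · rw [if_pos (decide_eq_true ha)]
    -- the least live copy of `a`
    set T : Finset (Fin M) := Finset.univ.filter fun j => π j = a ∧ z j = true with hT
    have hTne : T.Nonempty := by
      obtain ⟨j, hj⟩ := ha
      exact ⟨j, by simp [hT, hj]⟩
    set j₀ := T.min' hTne with hj₀
    have hj₀T : j₀ ∈ T := Finset.min'_mem T hTne
    have hj₀' : π j₀ = a ∧ z j₀ = true := by simpa [hT] using hj₀T
    rw [Finset.sum_eq_single j₀]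
    · rw [if_pos hj₀']
      simp only [aeval_X]
      rw [if_pos, hj₀'.1]
      refine ⟨hj₀'.2, fun j' hj' h' => ?_⟩
      have hj'T : j' ∈ T := by
        simp only [hT, Finset.mem_filter, Finset.mem_univ, true_and]
        exact ⟨h'.1.trans hj₀'.1, h'.2⟩
      have hle : j₀ ≤ j' := Finset.min'_le T j' hj'T
      exact absurd hle (not_le.2 hj')
    · intro j _ hne
      by_cases hj : π j = a ∧ z j = true
      · rw [if_pos hj]
        simp only [aeval_X]
        rw [if_neg]
        rintro ⟨-, hmin⟩
        have hjT : j ∈ T := by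
          simp only [hT, Finset.mem_filter, Finset.mem_univ, true_and]
          exact hj
        have hle : j₀ ≤ j := Finset.min'_le T j hjT
        rcases lt_or_eq_of_le hle with hlt | heq
        · exact hmin j₀ hlt ⟨hj₀'.1.trans hj.1.symm, hj₀'.2⟩
        · exact hne heq.symm
      · rw [if_neg hj, map_zero]
    · intro h
      exact absurd (Finset.mem_univ _) h
  · rw [if_neg (by simpa using ha)]
    refine Finset.sum_eq_zero fun j _ => ?_
    rw [if_neg, map_zero]
    exact fun hj => ha ⟨j, hj⟩

/-- The parallel substitution is injective on killed (= live-variable) polynomials. [folklore] -/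
theorem parallelSubst_killVars_eq_zero_iff (π : Fin M → Fin k) (z : Fin M → Bool)
    (p : MvPolynomial (Fin k) F) :
    MvPolynomial.aeval (R := F) (fun a : Fin k =>
        ∑ j : Fin M, if π j = a ∧ z j = true then (X j : MvPolynomial (Fin M) F) else 0)
      (killVars (fun a => decide (∃ j, π j = a ∧ z j = true)) p) = 0 ↔
    killVars (fun a => decide (∃ j, π j = a ∧ z j = true)) p = 0 := by
  constructor
  · intro h
    have h1 := congrArg (MvPolynomial.aeval (R := F) fun j : Fin M =>
        if z j = true ∧ ∀ j' < j, ¬ (π j' = π j ∧ z j' = true)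
        then (X (π j) : MvPolynomial (Fin k) F) else 0) h
    rw [map_zero, ← AlgHom.comp_apply, leftInv_comp_parallel, ← AlgHom.comp_apply,
      killVars_comp le_rfl] at h1
    exact h1
  · intro h
    rw [h, map_zero]

/-- **Parallel positions of a GRANK gate act as an OR, with the same data.** For GRANK data
`K₀, K_a ∈ F^{d×d}` (`a < k`) and `π : Fin M → Fin k`: the generic rank threshold of the data
`K₀, K_{π j}` (`j < M`) at input `z` equals that of `K₀, K_a` at `y_a = ⋁_{π j = a} z_j`.
[cite: Edmonds1967, §5 Thm. 1 and §7] -/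
theorem le_rank_symbolicMatrix_parallel_iff (π : Fin M → Fin k) (K₀ : Matrix (Fin d) (Fin d) F)
    (K : Fin k → Matrix (Fin d) (Fin d) F) (θ : ℕ) (z : Fin M → Bool) :
    θ ≤ (symbolicMatrix K₀ (fun j => K (π j)) z).rank ↔
      θ ≤ (symbolicMatrix K₀ K fun a => decide (∃ j, π j = a ∧ z j = true)).rank := by
  rw [Literature.LinearAlgebra.Matrix.le_rank_iff_exists_det_submatrix_ne_zero,
    Literature.LinearAlgebra.Matrix.le_rank_iff_exists_det_submatrix_ne_zero]
  refine exists_congr fun r => exists_congr fun c => ?_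
  rw [Ne, det_submatrix_symbolicMatrix_eq_zero_iff, Ne, det_submatrix_symbolicMatrix_eq_zero_iff,
    ← parallelSubst_killVars_eq_zero_iff π z, ← AlgHom.comp_apply, parallelSubst_comp_killVars,
    AlgHom.map_det, AlgHom.map_det, AlgHom.mapMatrix_apply, AlgHom.mapMatrix_apply,
    ← Matrix.submatrix_map, ← Matrix.submatrix_map, aeval_parallel_symbolicPolyMatrix]

end Parallel

/-- **Parallel positions of a GRANK gate act as an OR** (gate form): if `g` is a GRANK gate of
dimension `≤ s` with `k` positions and `π : Fin M → Fin k`, then `z ↦ g (fun a => ⋁_{π j = a} z_j)`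
is a GRANK gate of dimension `≤ s` over the SAME field with the SAME `K₀, θ` and `K'_j = K_{π j}`.
[folklore] -/
theorem isGRankGate_parallel {s : ℕ} {g : GateFn} (hg : IsGRankGate s g) {M : ℕ}
    (π : Fin M → Fin g.1) :
    IsGRankGate s ⟨M, fun z => g.2 fun a => decide (∃ j, π j = a ∧ z j = true)⟩ := by
  obtain ⟨F, _, d, θ, hd, K₀, K, hg⟩ := hg
  refine ⟨F, inferInstance, d, θ, hd, K₀, fun j => K (π j), fun z => ?_⟩
  exact (hg _).trans (le_rank_symbolicMatrix_parallel_iff π K₀ K θ z).symm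

/-! ### OR-substitution (a wide gate fed by ORs is ONE wide gate over the disjuncts) -/

/-- **`PERM ∘ OR ⊆ PERM`, same number of points.** Feeding position `a` of a PERM gate `g` with the
OR of the inputs `S a ⊆ Fin N` is ONE PERM gate `g'` on the same points whose positions — the
pairs `(a, i)`, `i ∈ S a` — are wired (`w`) to the inputs, repetitions allowed:
`g' (x ∘ w) = g (fun a => ⋁_{i ∈ S a} x_i)`. [folklore] -/
theorem isPermGate_substOr {s : ℕ} {g : GateFn} (hg : IsPermGate s g) {N : ℕ}
    (S : Fin g.1 → Finset (Fin N)) :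
    ∃ (g' : GateFn) (w : Fin g'.1 → Fin N), IsPermGate s g' ∧
      ∀ x : Fin N → Bool, g'.2 (fun j => x (w j)) = g.2 fun a => decide (∃ i ∈ S a, x i = true) := by
  classical
  let P : Type := {p : Fin g.1 × Fin N // p.2 ∈ S p.1}
  let e : P ≃ Fin (Fintype.card P) := Fintype.equivFin P
  refine ⟨_, fun j => (e.symm j).1.2, isPermGate_parallel hg (fun j => (e.symm j).1.1), fun x => ?_⟩
  refine congrArg g.2 (funext fun a => ?_)
  refine (decide_eq_decide (p := ∃ j, (e.symm j).1.1 = a ∧ x (e.symm j).1.2 = true)).2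
    ⟨?_, ?_⟩
  · rintro ⟨j, hja, hx⟩
    exact ⟨(e.symm j).1.2, hja ▸ (e.symm j).2, hx⟩
  · rintro ⟨i, hi, hx⟩
    refine ⟨e ⟨(a, i), hi⟩, ?_, ?_⟩ <;> simp [hx]

/-- **`GRANK ∘ OR ⊆ GRANK`, same dimension and field.** Feeding position `a` of a GRANK gate `g`
with the OR of the inputs `S a ⊆ Fin N` is ONE GRANK gate `g'` of the same dimension over the
same field (same `K₀, θ`; the copy `(a, i)` carries `K_a`) whose positions are wired (`w`) to the
inputs, repetitions allowed: `g' (x ∘ w) = g (fun a => ⋁_{i ∈ S a} x_i)`. [folklore] -/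
theorem isGRankGate_substOr : ∀ {s : ℕ} {g : GateFn}, IsGRankGate s g → ∀ {N : ℕ}
    (S : Fin g.1 → Finset (Fin N)),
    ∃ (g' : GateFn) (w : Fin g'.1 → Fin N), IsGRankGate s g' ∧
      ∀ x : Fin N → Bool, g'.2 (fun j => x (w j)) = g.2 fun a => decide (∃ i ∈ S a, x i = true) := by
  intro s g hg N S
  classical
  let P : Type := {p : Fin g.1 × Fin N // p.2 ∈ S p.1}
  let e : P ≃ Fin (Fintype.card P) := Fintype.equivFin P
  refine ⟨_, fun j => (e.symm j).1.2, isGRankGate_parallel hg (fun j => (e.symm j).1.1), fun x => ?_⟩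
  refine congrArg g.2 (funext fun a => ?_)
  refine (decide_eq_decide (p := ∃ j, (e.symm j).1.1 = a ∧ x (e.symm j).1.2 = true)).2
    ⟨?_, ?_⟩
  · rintro ⟨j, hja, hx⟩
    exact ⟨(e.symm j).1.2, hja ▸ (e.symm j).2, hx⟩
  · rintro ⟨i, hi, hx⟩
    refine ⟨e ⟨(a, i), hi⟩, ?_, ?_⟩ <;> simp [hx]

end Summit.PneNP.PneNP.Theorems
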